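import Summits.NavierStokesRegularity.NavierStokesRegularity.Theorems.EfficiencyFloorNearSaturationNearMaximiserSeqCoreRellichSplit
import Literature.Analysis.UnboundedOperators.HeatFlowCalculus
import Literature.Analysis.UnboundedOperators.HeatKernelSmooth
import HarnessLib

/-!
# Route `EfficiencyFloor`, crux `NearSaturationNearMaximiser` (stmt-NavierStokesRegularity-25482) on the
# `ProductionEfficiencyDecay` ladder (stmt-22866): FIRST BRICK OF LOCAL RELLICH — weak `L²` convergence becomes local strong
# convergence after heat mollification

Def-free helper file, fifteenth of the group. Hypothesis (R) of `nearSaturationNearMaximiser_of_rellich_of_identification`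
(`…SeqCoreRellichSplit`) is local Rellich–Kondrachov on `ℝ³`. Planned route (no Arzelà–Ascoli, no diagonal argument):
(1) sequential Banach–Alaoglu `g_{φk} ⇀ G` in `L²` (`…SeqCoreWeakLimit`, proved); (2) for `t > 0` the heat mollifications converge
POINTWISE, `e^{tΔ}g_{φk}(x) → e^{tΔ}G(x)` (weak convergence tested against the `L²` kernel `y ↦ G_t(x−y)`), and are uniformly bounded
(`enorm_heatExtension_le`), hence converge in `L²(B(0,R))` by dominated convergence — THIS FILE; (3) the mollification estimate
`‖g − e^{tΔ}g‖₂ ≤ C√t‖Dg‖₂` and the `L²`-continuity `e^{tΔ}G → G` (`heatExtension_sub_eq_integral_laplacian`,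
`eLpNorm_fderiv_heatExtension_apply_le`) — NEXT; (4) a `3ε` assembly.

* `tendsto_heatExtension_of_weak` — weak `L²` convergence ⟹ pointwise convergence of the heat mollifications;
* `norm_heatExtension_le_of_sq_le` — `‖e^{tΔ}g(x)‖ ≤ (4πt)^{-3/4} √C` when `∫‖g‖² ≤ C`;
* `tendsto_setIntegral_heatExtension_sub_sq_of_weak` — weak `L²` convergence ⟹ `∫_{B(0,R)}‖e^{tΔ}g_k − e^{tΔ}G‖² → 0`.

HONEST FRAMING: local Rellich is NOT yet assembled; stmt-25482, `LerayFloorGap`, `ProductionEfficiencyDecay` (stmt-22866) and Navier–Stokes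
regularity stay OPEN; no summit statement is proved. [folklore]
-/

-- the problem directory repeats the summit name (`NavierStokesRegularity/NavierStokesRegularity`)
set_option linter.dupNamespace false

noncomputable section

namespace Summit.NavierStokesRegularity.NavierStokesRegularity.Theorems

namespace NearSaturationNearMaximiser

namespace SeqCore

open Set MeasureTheory Filter Topology Function Real
open scoped InnerProductSpace ENNReal NNReal
open Literature.Analysis.UnboundedOperators

/-! ## §1 The `L²` test fields `y ↦ G_t(x − y) • e` and pointwise convergence of the mollifications -/

/-- The reflected heat kernel times a fixed vector is an `L²` test field. [folklore] -/
theorem memLp_two_heatKernel_sub_smul {t : ℝ} (ht : 0 < t) (x e : EuclideanSpace ℝ (Fin 3)) :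
    MemLp (fun y : EuclideanSpace ℝ (Fin 3) => heatKernel t (x - y) • e) 2 volume := by
  have hK : MemLp (fun y : EuclideanSpace ℝ (Fin 3) => heatKernel t (y - x)) 2 volume :=
    (memLp_heatKernel (E := EuclideanSpace ℝ (Fin 3)) ht one_le_two).comp_measurePreserving
      (measurePreserving_sub_right volume x)
  have hK' : MemLp (fun y : EuclideanSpace ℝ (Fin 3) => heatKernel t (x - y)) 2 volume := by
    refine hK.congr_norm ?_ (ae_of_all _ fun y => ?_)  -- same norm pointwise
    · exact ((continuous_heatKernel t).comp (continuous_const.sub continuous_id)).aestronglyMeasurable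
    · simp only [heatKernel, norm_sub_rev]
  have h := MemLp.smul (memLp_top_const e) hK' (p := 2) (q := ∞) (r := 2)
  exact h

/-- **Weak `L²` convergence gives pointwise convergence of the heat mollifications**: if `∫⟪g_k, ψ⟫ → ∫⟪G, ψ⟫` for every `ψ ∈ L²`
(`g_k, G ∈ L²`), then `e^{tΔ}g_k(x) → e^{tΔ}G(x)` for every `t > 0` and `x`. [folklore] -/
theorem tendsto_heatExtension_of_weak {g : ℕ → EuclideanSpace ℝ (Fin 3) → EuclideanSpace ℝ (Fin 3)}
    {G : EuclideanSpace ℝ (Fin 3) → EuclideanSpace ℝ (Fin 3)} (hg : ∀ k, MemLp (g k) 2 volume) (hG : MemLp G 2 volume)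
    (hweak : ∀ ψ : EuclideanSpace ℝ (Fin 3) → EuclideanSpace ℝ (Fin 3), MemLp ψ 2 volume →
      Tendsto (fun k => ∫ y, ⟪g k y, ψ y⟫_ℝ) atTop (𝓝 (∫ y, ⟪G y, ψ y⟫_ℝ)))
    {t : ℝ} (ht : 0 < t) (x : EuclideanSpace ℝ (Fin 3)) :
    Tendsto (fun k => heatExtension (g k) t x) atTop (𝓝 (heatExtension G t x)) := by
  set b := EuclideanSpace.basisFun (Fin 3) ℝ with hb
  -- integrability of the convolution integrands
  have hI : ∀ f : EuclideanSpace ℝ (Fin 3) → EuclideanSpace ℝ (Fin 3), MemLp f 2 volume →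
      Integrable (fun y => heatKernel t (x - y) • f y) := by
    intro f hf
    have h := integrable_temperate_mul_heatKernel_smul (F := EuclideanSpace ℝ (Fin 3)) ht hf one_le_two
      (Function.HasTemperateGrowth.const (1 : ℝ)) x
    exact h.congr (ae_of_all _ fun y => by simp only [one_mul])
  -- coordinates: `⟪e, e^{tΔ}f x⟫ = ∫⟪f y, G_t(x−y) • e⟫`
  have hcoord : ∀ (f : EuclideanSpace ℝ (Fin 3) → EuclideanSpace ℝ (Fin 3)), MemLp f 2 volume → ∀ e : EuclideanSpace ℝ (Fin 3),
      ⟪e, heatExtension f t x⟫_ℝ = ∫ y, ⟪f y, heatKernel t (x - y) • e⟫_ℝ := by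
    intro f hf e
    rw [heatExtension_eq_integral_sub, ← integral_inner (hI f hf) e]
    refine integral_congr_ae (ae_of_all _ fun y => ?_)
    show ⟪e, heatKernel t (x - y) • f y⟫_ℝ = ⟪f y, heatKernel t (x - y) • e⟫_ℝ
    rw [real_inner_smul_right, real_inner_smul_right, real_inner_comm]
  have hc : ∀ i, Tendsto (fun k => ⟪b i, heatExtension (g k) t x⟫_ℝ) atTop (𝓝 ⟪b i, heatExtension G t x⟫_ℝ) := by
    intro i
    have h := hweak _ (memLp_two_heatKernel_sub_smul ht x (b i))
    rw [← hcoord G hG (b i)] at h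
    exact h.congr fun k => (hcoord (g k) (hg k) (b i)).symm
  have hsum : Tendsto (fun k => ∑ i, ⟪b i, heatExtension (g k) t x⟫_ℝ • b i) atTop
      (𝓝 (∑ i, ⟪b i, heatExtension G t x⟫_ℝ • b i)) :=
    tendsto_finsetSum _ fun i _ => (hc i).smul_const _
  simp only [hb, OrthonormalBasis.sum_repr'] at hsum
  exact hsum

/-! ## §2 Uniform bound and dominated convergence on balls -/

/-- **Uniform bound of the heat mollification**: `‖e^{tΔ}g(x)‖ ≤ ((4πt)^{-3/2})^{1/2} · √C` when `∫‖g‖² ≤ C` (`g ∈ L²(ℝ³)`). [folklore] -/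
theorem norm_heatExtension_le_of_sq_le {g : EuclideanSpace ℝ (Fin 3) → EuclideanSpace ℝ (Fin 3)} (hg : MemLp g 2 volume)
    {C : ℝ} (hC : ∫ y, ‖g y‖ ^ 2 ≤ C) {t : ℝ} (ht : 0 < t) (x : EuclideanSpace ℝ (Fin 3)) :
    ‖heatExtension g t x‖ ≤ ((4 * π * t) ^ (-(3 : ℝ) / 2)) ^ (1 / 2 : ℝ) * Real.sqrt C := by
  have hC0 : 0 ≤ C := (integral_nonneg fun y => by positivity).trans hC
  have h := enorm_heatExtension_le hg one_le_two ht x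
  have hfin : (Module.finrank ℝ (EuclideanSpace ℝ (Fin 3)) : ℝ) = 3 := by simp
  rw [hfin] at h
  -- `eLpNorm g 2 ≤ ofReal √C`
  have hnorm : eLpNorm g 2 volume ≤ ENNReal.ofReal (Real.sqrt C) := by
    rw [hg.eLpNorm_eq_integral_rpow_norm (by norm_num) (by norm_num)]
    simp only [ENNReal.toReal_ofNat, Real.rpow_two]
    rw [← one_div, ← Real.sqrt_eq_rpow]
    exact ENNReal.ofReal_le_ofReal (Real.sqrt_le_sqrt hC)
  have hA0 : 0 ≤ (4 * π * t) ^ (-(3 : ℝ) / 2) := Real.rpow_nonneg (by positivity) _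
  have h2 : ‖heatExtension g t x‖ₑ ≤ ENNReal.ofReal (((4 * π * t) ^ (-(3 : ℝ) / 2)) ^ (1 / 2 : ℝ) * Real.sqrt C) := by
    refine h.trans ?_
    rw [ENNReal.ofReal_mul (Real.rpow_nonneg hA0 _), ENNReal.ofReal_rpow_of_nonneg hA0 (by norm_num)]
    simp only [ENNReal.toReal_inv, ENNReal.toReal_ofNat, one_div]
    exact mul_le_mul_right hnorm _
  rw [← ofReal_norm] at h2
  exact (ENNReal.ofReal_le_ofReal_iff (by positivity)).1 h2

/-- **Weak `L²` convergence becomes local strong convergence after heat mollification.** If `g_k ⇀ G` in `L²` (pairings against all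
`L²` fields) with `∫‖g_k‖² ≤ C`, then for every `t > 0` and `R`: `∫_{B(0,R)} ‖e^{tΔ}g_k − e^{tΔ}G‖² → 0` (pointwise convergence + uniform
bound + dominated convergence on the ball). [folklore] -/
theorem tendsto_setIntegral_heatExtension_sub_sq_of_weak {g : ℕ → EuclideanSpace ℝ (Fin 3) → EuclideanSpace ℝ (Fin 3)}
    {G : EuclideanSpace ℝ (Fin 3) → EuclideanSpace ℝ (Fin 3)} (hg : ∀ k, MemLp (g k) 2 volume) (hG : MemLp G 2 volume)
    {C : ℝ} (hC : ∀ k, ∫ y, ‖g k y‖ ^ 2 ≤ C)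
    (hweak : ∀ ψ : EuclideanSpace ℝ (Fin 3) → EuclideanSpace ℝ (Fin 3), MemLp ψ 2 volume →
      Tendsto (fun k => ∫ y, ⟪g k y, ψ y⟫_ℝ) atTop (𝓝 (∫ y, ⟪G y, ψ y⟫_ℝ)))
    {t : ℝ} (ht : 0 < t) (R : ℝ) :
    Tendsto (fun k => ∫ x in Metric.ball (0 : EuclideanSpace ℝ (Fin 3)) R, ‖heatExtension (g k) t x - heatExtension G t x‖ ^ 2)
      atTop (𝓝 0) := by
  -- uniform bounds
  set A : ℝ := ((4 * π * t) ^ (-(3 : ℝ) / 2)) ^ (1 / 2 : ℝ) with hA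
  set CG : ℝ := ∫ y, ‖G y‖ ^ 2 with hCG
  have hbk : ∀ k x, ‖heatExtension (g k) t x‖ ≤ A * Real.sqrt C := fun k x => norm_heatExtension_le_of_sq_le (hg k) (hC k) ht x
  have hbG : ∀ x, ‖heatExtension G t x‖ ≤ A * Real.sqrt CG := fun x => norm_heatExtension_le_of_sq_le hG le_rfl ht x
  -- continuity (measurability) of the mollifications
  have hck : ∀ k, Continuous (heatExtension (g k) t) := fun k =>
    (contDiff_heatExtension_holds (E := EuclideanSpace ℝ (Fin 3)) (F := EuclideanSpace ℝ (Fin 3)) (hg k) one_le_two ht).continuous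
  have hcG : Continuous (heatExtension G t) :=
    (contDiff_heatExtension_holds (E := EuclideanSpace ℝ (Fin 3)) (F := EuclideanSpace ℝ (Fin 3)) hG one_le_two ht).continuous
  -- dominated convergence on the ball
  set D : ℝ := (A * Real.sqrt C + A * Real.sqrt CG) ^ 2 with hD
  have hμ : (volume : Measure (EuclideanSpace ℝ (Fin 3))) (Metric.ball (0 : EuclideanSpace ℝ (Fin 3)) R) < ⊤ := measure_ball_lt_top
  have h := tendsto_integral_of_dominated_convergence (μ := (volume : Measure (EuclideanSpace ℝ (Fin 3))).restrict
      (Metric.ball (0 : EuclideanSpace ℝ (Fin 3)) R))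
    (F := fun k x => ‖heatExtension (g k) t x - heatExtension G t x‖ ^ 2) (f := fun _ => (0 : ℝ)) (fun _ => D)
    (fun k => (((hck k).sub hcG).norm.pow 2).aestronglyMeasurable)
    (integrableOn_const (hs := hμ.ne) (C := D)) (fun k => ae_of_all _ fun x => ?_) (ae_of_all _ fun x => ?_)
  · simpa only [integral_zero] using h
  · rw [Real.norm_of_nonneg (sq_nonneg _), hD]
    refine pow_le_pow_left₀ (norm_nonneg _) ((norm_sub_le _ _).trans (add_le_add (hbk k x) (hbG x))) 2
  · have hpt := tendsto_heatExtension_of_weak hg hG hweak ht x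
    have h0 : Tendsto (fun k => ‖heatExtension (g k) t x - heatExtension G t x‖ ^ 2) atTop
        (𝓝 (‖heatExtension G t x - heatExtension G t x‖ ^ 2)) := ((hpt.sub_const _).norm).pow 2
    rwa [sub_self, norm_zero, zero_pow two_ne_zero] at h0

end SeqCore

end NearSaturationNearMaximiser

end Summit.NavierStokesRegularity.NavierStokesRegularity.Theorems

end
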